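import Literature.MathematicalPhysics.StatisticalMechanics.ComplexSpinReflectionPositivity
import HarnessLib

/-!
# Zeros of monomer–dimer partition functions (Heilmann–Lieb) and the NJL system at complex mass
# (Salmhofer–Seiler, CMP 139 (1991), §3 "NJL Model: Rigorous Results": Thm. 3.6, (3.28), Cor. 3.9)

A further file of the Salmhofer–Seiler series (`ComplexSpinInfraredBound`, …,
`ComplexSpinThermodynamicLimit`, `StrongCouplingBosonisation`).  The series has formalised the
paper's §3–§4 and §2 at `β = 0` for REAL mass `m`; the one numbered result of §3 not yet in the tree
is the input of its analyticity/clustering statements (Thm. 3.8, Cor. 3.9, Thm. 3.11):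

* **Theorem 3.6** (p. 407; Heilmann–Lieb [21], Gruber–Kunz [20]): "Let `G` be a graph, `w_xy ≥ 0`
  for all `(x,y) ∈ B(G)` and `Re m_x > 0` for all `x ∈ V(G)` (or `Re m_x < 0` for all `x ∈ V(G)`).
  Then `Z_G ≠ 0` (3.27).  *Proof.* See [20, 21].  The absolute value of the zeros of `Z_G(m)` cannot
  exceed `[2√W]` [21], where `W = max_x ∑_y w_xy` (3.28).  For the NJL model on `Λ`, `W = 2νN` does
  not depend on `|Λ|`. … Let `𝒲 = ℂ ∖ 2i[-√(2νN), √(2νN)]`."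
* **Corollary 3.9** (p. 407): "Let `m ∈ ℝ`.  A phase transition can occur in a NJL model only if
  `m = 0`.  For `m ≠ 0`, all correlation functions are analytic in `m`."  (Printed as a corollary of
  Thm. 3.8, whose part (2) is analyticity of the thermodynamic limit on `𝒲`; here the finite-volume
  statement is proved: holomorphy of every `⟨Φ⟩_Λ(m)` on the zero-free region, for every volume,
  with volume-independent bounds — the Vitali input for Thm. 3.8, see "NOT formalised" below.)
* Remark 3.4(3) (p. 403): "The NJL system on `G` can be mapped to an ordinary monomer–dimer system
  on a graph with vertex set `V(G) × {1,…,N}`", proved on p. 404 through the fermionic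
  representation (3.10)–(3.15).
* Heilmann–Lieb, CMP 25 (1972): Thm. 4.6 / Lemma 4.7 (vertex-dependent complex activities,
  `Re x_i > 0 ⇒ P(G; x) ≠ 0`, by induction with the recursion (4.11),
  `Q(G'; x)/Q(G'-i; x) = x_i - ∑_j W(i,j) Q(G'-i-j)/Q(G'-i)` (4.20), base `1/x_i` (4.19)) and Thm. 4.3
  / Lemma 4.4 (the zeros satisfy `|a_i| < 2√B₁`, `B₁ = max_i ∑_j W(i,j)` (4.8)–(4.10), by the same
  induction with `Q(G')/Q(G'-i) ≥ ½ x`).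

HOW IT IS TYPED.  Salmhofer–Seiler define complex spin systems by contour integrals which, by their
Remark 3.2, are coefficient extractions; the tree renders them in `MvPolynomial` (`ComplexSpin.bracket`,
`bracketC`).  Part I of this file sets up, on an ARBITRARY finite vertex set `V` with bonds indexed by
a finite type `β` (end points `s, t : β → V`; multiple bonds and self-bonds allowed), the Boltzmann
polynomial `∏_x F_x(σ_x) ∏_b B_b(σ_{s b} σ_{t b})` with Taylor data `f_x`, `g_b` truncated at degree
`D` (`MonomerDimer.boltzmann`) and the **capacity partition functions**
`Z(c) = [∏_x σ_x^{c_x}] ∏ F ∏ B` (`MonomerDimer.Z`, `c : V →₀ ℕ`, `c ≤ D`).  For exponential data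
(`F_x = e^{a_x σ}`, `B_b = e^{w_b σσ'}`, `MonomerDimer.IsExpData`) and `c ≡ 1` this is the monomer–dimer
partition function (3.5)–(3.7); for `c ≡ N` it is the NJL complex spin system, i.e. by Remark 3.4(3)
the monomer–dimer system on `V × {1,…,N}` (up to the factor `∏ c_x!`).  The Heilmann–Lieb vertex
recursion on `V × {1,…,N}`, pushed down to `V`, is the identity
`c_z Z(c) = a_z Z(c-δ_z) + ∑_b w_b ([s b = z] Z(c-δ_z-δ_{t b}) + [t b = z] Z(c-δ_z-δ_{s b}))`
(`MonomerDimer.rec`) — nothing but Salmhofer–Seiler's own "integration by parts in `σ_z`" (3.45),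
i.e. their Schwinger–Dyson equation (3.46) for the NJL system; we prove it directly with the Euler
operator `σ_z∂_z` (as in `ComplexSpinSchwingerDyson`, here over a general coefficient ring), so the
graph `V × {1,…,N}` never has to be built.  On this recursion the two Heilmann–Lieb inductions run
verbatim: `MonomerDimer.heilmannLieb` (Thm. 4.6/Lemma 4.7 = SS Thm. 3.6, with the ratio information
`ε Re (Z(c-δ_z)/Z(c)) > 0`, `|Z(c-δ_z)/Z(c)| ≤ c_z/(ε Re a_z)`) and `MonomerDimer.heilmannLieb_rootBound`
(Thm. 4.3/Lemma 4.4 = SS (3.28): `‖a_x‖ ≥ R`, `R² ≥ 4 W_x(c)` ⇒ `Z(c) ≠ 0`, `|Z(c-δ_z)/Z(c)| ≤ 2c_z/R`,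
`W_x(c)` = `MonomerDimer.weightedDegree`), and telescoping gives volume-independent bounds on all
ratios `Z(d)/Z(c)`, `d ≤ c` (`norm_Z_div_Z_le_of_re`, `norm_Z_div_Z_le_of_norm`).

Part II instantiates Part I on the torus `Λ = (ℤ/Lℤ)^ν` with the links `(x, μ) ↦ (x, x+e_μ)` of
(2.21), site data `(2Nm)^j/j!` at COMPLEX `m` and the tree's NJL bond data `njlBondCoeff N`
(`B = e^{Nt}`, `w₁ = 1`): `ComplexSpin.njlBoltzmannC`, `njlBracketC`, `njlPartitionFunctionC`,
`njlExpectC`, shown to coincide at real `m` with the tree's `boltzmannC`/`bracket`/`partitionFunction`/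
`expect` of the NJL system (`njlBoltzmannC_ofReal`, `njlBracketC_ofReal`, `njlPartitionFunctionC_ofReal`,
`njlExpectC_ofReal`).  Results: **Thm. 3.6 for the NJL system** `njlPartitionFunctionC_ne_zero_of_re_ne_zero`
(all zeros of `Z_Λ(m)` purely imaginary; real form `njl_partitionFunction_ne_zero`); **(3.28)**
`njlPartitionFunctionC_ne_zero_of_sqrt_le_norm` (no zeros with `|m| ≥ √(2ν)`), the zero locus
`njlPartitionFunctionC_eq_zero_imp` and the printed region `njlPartitionFunctionC_ne_zero_of_mem_printedRegion`
(`𝒲 = ℂ ∖ 2i[-√(2νN), √(2νN)]`); **Cor. 3.9 in finite volume** `differentiable_njlBracketC`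
(`[Φ]_Λ(m)` is a polynomial in `m`, `njlBracketPoly`/`eval_njlBracketPoly`), `differentiableOn_njlExpectC`
(`_of_re`, `_printedRegion`); and the **volume-independent bounds** `norm_njlExpectC_monomial_le_of_re`
(`|⟨σ^l⟩_Λ(m)| ≤ (2|Re m|)^{-|l|}`), `norm_njlExpectC_monomial_le_of_norm` (`≤ |m|^{-|l|}` for
`|m| ≥ √(2ν)`), `njl_abs_expect_monomial_le` (real `m ≠ 0`, tree vocabulary).

FAITHFULNESS NOTES.
* Constants.  In the tree's normalisation (`F = e^{2Nmz}`, `B = e^{Nt}`, capacities `N`) the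
  Heilmann–Lieb bound reads `|m| < √(2ν)` for every zero, for all `N`; the printed
  `𝒲 = ℂ ∖ 2i[-√(2νN), √(2νN)]` is contained in the proved zero-free region (`√(2ν) ≤ 2√(2νN)` for
  `N ≥ 1`), so every statement "on `𝒲`" below is implied and nothing printed is strengthened into
  falsity; we record the printed region as a corollary.
* Thm. 3.6 is printed for general graphs with site-dependent `m_x`; Part I is that generality (and
  more: bond multiplicities/capacities), Part II the case the paper uses.
* The Erratum (CMP 146 (1992) 637) notes that `|⟨σ^L⟩_Λ| ≤ 1` holds only for real `m` and replaces it
  for complex `m` by a negative power of `|Re m|`; `norm_njlExpectC_monomial_le_of_re` is exactly such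
  a bound, obtained here from the Heilmann–Lieb ratios rather than from the transfer operator.
* NOT formalised here: Thm. 3.8(1) (existence of the thermodynamic limit on `𝒲` along van Hove
  sequences — printed proof "contained in [20]", i.e. the Gruber–Kunz cluster expansion at large `|m|`
  plus Vitali's theorem; the tree has Vitali, `Literature.Analysis.Complex.VitaliConvergence`, and
  this file supplies holomorphy and local boundedness uniformly in the volume, so what remains is
  the convergence at large `|m|`), Thm. 3.11 (exponential clustering via subharmonicity
  (3.33)–(3.42)), Remark 3.10 (radius of the hopping expansion).  Honest framing: statements about
  polynomial partition functions of `β = 0` complex spin systems in finite volume; nothing about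
  `β > 0`, the continuum, a mass gap or the summit's `QCD` conjunct.

## References

* M. Salmhofer, E. Seiler, *Proof of chiral symmetry breaking in strongly coupled lattice gauge
  theory*, Commun. Math. Phys. 139 (1991) 395–432: Remark 3.2 p. 402, Def. 3.3 / Remark 3.4 p. 403,
  Thm. 3.6 (3.27)–(3.28), Def. 3.7, Thm. 3.8, Cor. 3.9, Remark 3.10 p. 407. [SalmhoferSeiler1991]
* M. Salmhofer, E. Seiler, Erratum, Commun. Math. Phys. 146 (1992) 637–638. [SalmhoferSeiler1992Erratum]
* O. J. Heilmann, E. H. Lieb, *Theory of monomer-dimer systems*, Commun. Math. Phys. 25 (1972)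
  190–232: (4.8)–(4.11), Thm. 4.3, Lemma 4.4, Thm. 4.6, Lemma 4.7 ((4.19)–(4.20)). [HeilmannLieb1972]
* C. Gruber, H. Kunz, *General properties of polymer systems*, Commun. Math. Phys. 22 (1971)
  133–161 (SS91's [20]: analyticity and the thermodynamic limit in the zero-free region). [GruberKunz1971]
-/

noncomputable section

open MvPolynomial Finset

namespace Literature.MathematicalPhysics.StatisticalMechanics

namespace MonomerDimer

/-! ### The Euler operator `σ_z ∂/∂σ_z` and terms of high degree -/

section Euler

variable {σ R : Type*} [CommRing R]

/-- The Euler operator `σ_z ∂/∂σ_z` on polynomials with coefficients in `R` — the algebraic form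
of the integration by parts in the contour integral over `σ_z` behind the monomer–dimer recursion
(Heilmann–Lieb (4.11); Salmhofer–Seiler (3.45)). [cite: SalmhoferSeiler1991, (3.45)] -/
def euler (z : σ) (p : MvPolynomial σ R) : MvPolynomial σ R :=
  X z * pderiv z p

/-- `σ_z∂_z` multiplies the coefficient of `σ^d` by `d_z`. [cite: SalmhoferSeiler1991, (3.45)] -/
theorem coeff_euler (z : σ) (p : MvPolynomial σ R) (d : σ →₀ ℕ) :
    coeff d (euler z p) = (d z : R) * coeff d p := by
  classical
  unfold euler
  rw [coeff_X_mul']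
  by_cases h : d z = 0
  · have hz : z ∉ d.support := by simp [Finsupp.mem_support_iff, h]
    rw [if_neg hz, h, Nat.cast_zero, zero_mul]
  · have hz : z ∈ d.support := by simp [Finsupp.mem_support_iff, h]
    have hle : Finsupp.single z 1 ≤ d := by
      rw [Finsupp.single_le_iff]; omega
    rw [if_pos hz, coeff_pderiv, tsub_add_cancel_of_le hle]
    have hdz : (((d - Finsupp.single z 1 : σ →₀ ℕ) z : ℕ) : R) + 1 = (d z : R) := by
      rw [Finsupp.tsub_apply, Finsupp.single_eq_same]
      have : d z - 1 + 1 = d z := by omega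
      have h2 : ((d z - 1 + 1 : ℕ) : R) = (d z : R) := by rw [this]
      push_cast at h2
      exact h2
    rw [hdz, mul_comm]

/-- `σ_z∂_z` is a derivation. [folklore] -/
private theorem euler_mul (z : σ) (p q : MvPolynomial σ R) :
    euler z (p * q) = euler z p * q + p * euler z q := by
  unfold euler
  rw [pderiv_mul]
  ring

/-- `σ_z∂_z` commutes with finite sums. [folklore] -/
private theorem euler_sum (z : σ) {ι : Type*} (s : Finset ι) (f : ι → MvPolynomial σ R) :
    euler z (∑ i ∈ s, f i) = ∑ i ∈ s, euler z (f i) := by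
  unfold euler
  rw [map_sum, Finset.mul_sum]

/-- `σ_z∂_z (c Φ) = c σ_z∂_z Φ`. [folklore] -/
private theorem euler_C_mul (z : σ) (c : R) (p : MvPolynomial σ R) :
    euler z (C c * p) = C c * euler z p := by
  unfold euler
  rw [pderiv_C_mul]
  ring

/-- `σ_z∂_z 1 = 0`. [folklore] -/
private theorem euler_one (z : σ) : euler z (1 : MvPolynomial σ R) = 0 := by
  unfold euler
  rw [pderiv_one, mul_zero]

/-- `σ_z∂_z σ^d = d_z σ^d`. [folklore] -/
private theorem euler_monomial (z : σ) (d : σ →₀ ℕ) (c : R) :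
    euler z (monomial d c) = C (d z : R) * monomial d c := by
  unfold euler
  rw [X_mul_pderiv_monomial, C_mul_monomial, smul_monomial, nsmul_eq_mul]

/-- `σ_z∂_z (σ_x σ_y)^k = ((kδ_x + kδ_y)_z) (σ_x σ_y)^k`. [folklore] -/
private theorem euler_XX_pow (z x y : σ) (k : ℕ) :
    euler z ((X x * X y : MvPolynomial σ R) ^ k) =
      C (((Finsupp.single x k + Finsupp.single y k) z : ℕ) : R) * (X x * X y) ^ k := by
  have hm : (X x * X y : MvPolynomial σ R) ^ k =
      monomial (Finsupp.single x k + Finsupp.single y k) 1 := by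
    rw [mul_pow, X_pow_eq_monomial, X_pow_eq_monomial, monomial_mul, mul_one]
  rw [hm, euler_monomial]

/-- `σ_z∂_z σ_x^j = j_z σ_x^j`. [folklore] -/
private theorem euler_X_pow (z x : σ) (j : ℕ) :
    euler z ((X x : MvPolynomial σ R) ^ j) = C (((Finsupp.single x j) z : ℕ) : R) * X x ^ j := by
  rw [X_pow_eq_monomial, euler_monomial]

/-- "`σ_z^{D+1}` appears in the numerator": every monomial of `p` has `z`-degree `> D`; such terms
are invisible to the coefficient extractions `[∏ σ_x^{c_x}]` with `c_z ≤ D`.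
[cite: SalmhoferSeiler1991, Remark 3.2 and proof of (3.44)] -/
def HighDeg (D : ℕ) (z : σ) (p : MvPolynomial σ R) : Prop :=
  ∀ d, coeff d p ≠ 0 → D < d z

/-- `0` is high. [folklore] -/
private theorem HighDeg.zero (D : ℕ) (z : σ) : HighDeg D z (0 : MvPolynomial σ R) :=
  fun d h => (h (coeff_zero d)).elim

/-- Sums of high polynomials are high. [folklore] -/
private theorem HighDeg.add {D : ℕ} {z : σ} {p q : MvPolynomial σ R} (hp : HighDeg D z p)
    (hq : HighDeg D z q) : HighDeg D z (p + q) := by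
  intro d hd
  rw [coeff_add] at hd
  by_cases h1 : coeff d p = 0
  · rw [h1, zero_add] at hd
    exact hq d hd
  · exact hp d h1

/-- High polynomials form an ideal: `q · p` is high if `p` is. [folklore] -/
private theorem HighDeg.mul_left {D : ℕ} {z : σ} {p : MvPolynomial σ R} (hp : HighDeg D z p)
    (q : MvPolynomial σ R) : HighDeg D z (q * p) := by
  classical
  intro d hd
  rw [coeff_mul] at hd
  obtain ⟨x, hx, hne⟩ := Finset.exists_ne_zero_of_sum_ne_zero hd
  have h2 : coeff x.2 p ≠ 0 := fun h => hne (by rw [h, mul_zero])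
  have hlt := hp x.2 h2
  have hx' : x.1 + x.2 = d := by simpa [Finset.mem_antidiagonal] using hx
  have : x.2 z ≤ d z := by
    rw [← hx', Finsupp.add_apply]
    omega
  omega

/-- `p · q` is high if `p` is. [folklore] -/
private theorem HighDeg.mul_right {D : ℕ} {z : σ} {p : MvPolynomial σ R} (hp : HighDeg D z p)
    (q : MvPolynomial σ R) : HighDeg D z (p * q) := by
  rw [mul_comm]
  exact hp.mul_left q

/-- `σ_z^{D+1} · q` is high. [folklore] -/
private theorem HighDeg.X_pow_mul (D : ℕ) (z : σ) (q : MvPolynomial σ R) :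
    HighDeg D z (X z ^ (D + 1) * q) := by
  classical
  have h : HighDeg D z (X z ^ (D + 1) : MvPolynomial σ R) := by
    intro d hd
    rw [coeff_X_pow] at hd
    by_cases he : Finsupp.single z (D + 1) = d
    · rw [← he, Finsupp.single_eq_same]; omega
    · exact (hd (if_neg he)).elim
  exact h.mul_right q

/-- High terms do not contribute to `[∏ σ_x^{c_x}]` when `c_z ≤ D`. [cite: SalmhoferSeiler1991, Remark 3.2] -/
theorem HighDeg.coeff_eq_zero {D : ℕ} {z : σ} {p : MvPolynomial σ R} (hp : HighDeg D z p)
    {c : σ →₀ ℕ} (hc : c z ≤ D) : coeff c p = 0 := by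
  by_contra h
  exact absurd (hp c h) (not_lt.2 hc)

/-- **Leibniz rule over a product, modulo high terms**: if `σ_z∂_z f_i = q_i f_i + h_i` with `h_i`
high for every factor, then `σ_z∂_z ∏ f_i = (∑ q_i) ∏ f_i + H` with `H` high. [folklore] -/
private theorem euler_prod_of {D : ℕ} {z : σ} {ι : Type*} [DecidableEq ι] (s : Finset ι)
    (f q : ι → MvPolynomial σ R)
    (hf : ∀ i ∈ s, ∃ h, HighDeg D z h ∧ euler z (f i) = q i * f i + h) :
    ∃ H, HighDeg D z H ∧ euler z (∏ i ∈ s, f i) = (∑ i ∈ s, q i) * ∏ i ∈ s, f i + H := by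
  induction s using Finset.induction_on with
  | empty =>
    refine ⟨0, HighDeg.zero D z, ?_⟩
    rw [Finset.prod_empty, Finset.sum_empty, euler_one, zero_mul, zero_add]
  | @insert b s hb ih =>
    obtain ⟨H, hH, hprod⟩ := ih fun i hi => hf i (Finset.mem_insert_of_mem hi)
    obtain ⟨h, hh, hfb⟩ := hf b (Finset.mem_insert_self b s)
    refine ⟨h * ∏ i ∈ s, f i + f b * H, (hh.mul_right _).add (hH.mul_left _), ?_⟩
    rw [Finset.prod_insert hb, Finset.sum_insert hb, euler_mul, hprod, hfb]
    ring

end Euler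

/-! ### Monomer–dimer (capacity) systems on a finite vertex set -/

section Defs

variable {V β R : Type*} [CommRing R]

/-- The truncated site factor `F_x^{≤D}(σ_x) = ∑_{j=0}^{D} f_x(j) σ_x^j` with Taylor data `f_x`
(for the monomer–dimer system `f_x(j) = m_x^j / j!`, i.e. `F_x = e^{m_x σ_x}`; only degrees `≤ D`
matter under `[∏ σ_x^{c_x}]`, `c_x ≤ D`). [cite: SalmhoferSeiler1991, Def. 3.1 and Remark 3.2] -/
def siteFactor (D : ℕ) (f : V → ℕ → R) (x : V) : MvPolynomial V R :=
  ∑ j ∈ range (D + 1), C (f x j) * X x ^ j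

/-- The truncated bond factor `B_b^{≤D}(σ_{s b} σ_{t b}) = ∑_{j=0}^{D} g_b(j) (σ_{s b} σ_{t b})^j` of
the bond `b` with end points `s b`, `t b` (for the monomer–dimer system `g_b(j) = w_b^j / j!`,
i.e. `B_b = e^{w_b σ σ'}`). [cite: SalmhoferSeiler1991, Def. 3.1 and (3.5)] -/
def bondFactor (D : ℕ) (s t : β → V) (g : β → ℕ → R) (b : β) : MvPolynomial V R :=
  ∑ j ∈ range (D + 1), C (g b j) * (X (s b) * X (t b)) ^ j

variable [Fintype V] [Fintype β]

/-- The Boltzmann polynomial `∏_x F_x(σ_x) ∏_b B_b(σ_{s b} σ_{t b})` of the complex spin system on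
the vertex set `V` with bonds indexed by `β`. [cite: SalmhoferSeiler1991, (3.1)] -/
def boltzmann (D : ℕ) (s t : β → V) (f : V → ℕ → R) (g : β → ℕ → R) : MvPolynomial V R :=
  (∏ x, siteFactor D f x) * ∏ b, bondFactor D s t g b

/-- The partition function with capacities `c`: `Z(c) = [∏_x σ_x^{c_x}] ∏_x F_x ∏_b B_b` — the contour
integral `∮ ∏_x dσ_x/(2πi σ_x^{c_x+1}) ∏ F_x ∏ B_b` of Definition 3.1.  For `c ≡ 1`,
`F_x = e^{m_x σ}`, `B_b = e^{w_b σσ'}` this is the monomer–dimer partition function (3.7)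
`∑_{dimer arrangements} ∏ w_b ∏_{uncovered x} m_x`; for capacities `c_x = N` it is the NJL complex
spin system, i.e. the monomer–dimer system on `V × {1,…,N}` of Remark 3.4(3) divided by `(N!)^{|V|}`.
[cite: SalmhoferSeiler1991, (3.1), (3.5)–(3.7) and Remark 3.4(3)] -/
def Z (D : ℕ) (s t : β → V) (f : V → ℕ → R) (g : β → ℕ → R) (c : V →₀ ℕ) : R :=
  coeff c (boltzmann D s t f g)

variable [DecidableEq V]

/-- `Z` with one unit of capacity removed at `y`, and `0` if there is none to remove: the partition
function of the graph with the vertex `(y, ·)` deleted. [cite: HeilmannLieb1972, (4.11)] -/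
def Zdrop (D : ℕ) (s t : β → V) (f : V → ℕ → R) (g : β → ℕ → R) (d : V →₀ ℕ) (y : V) : R :=
  if y ∈ d.support then Z D s t f g (d - Finsupp.single y 1) else 0

end Defs

/-- Taylor data of an exponential `e^{a t} = ∑_j e_j t^j`: `e_0 = 1` and `(j+1) e_{j+1} = a e_j`
(division-free form of `e_j = a^j/j!`) — the shape of the NJL weights `F = e^{2Nmz}`, `B = e^{Nt}`
(Def. 3.3(1), (3.58)) and of the monomer–dimer weights `e^{m_x σ}`, `e^{w_xy σσ'}` (3.5).
[cite: SalmhoferSeiler1991, Def. 3.3(1) and (3.5)] -/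
def IsExpData {R : Type*} [CommRing R] (a : R) (e : ℕ → R) : Prop :=
  e 0 = 1 ∧ ∀ j : ℕ, ((j : R) + 1) * e (j + 1) = a * e j

/-- `a^j/j!` are the Taylor data of `e^{at}`. [folklore] -/
private theorem isExpData_pow_div_factorial {R : Type*} [Field R] [CharZero R] (a : R) :
    IsExpData a (fun j => a ^ j / (Nat.factorial j : R)) := by
  refine ⟨by simp, fun j => ?_⟩
  have hj : ((Nat.factorial j : ℕ) : R) ≠ 0 := by exact_mod_cast (Nat.factorial_pos j).ne'
  have hj1 : ((j : R) + 1) ≠ 0 := by exact_mod_cast (Nat.succ_ne_zero j)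
  show ((j : R) + 1) * (a ^ (j + 1) / ((j + 1).factorial : R)) = a * (a ^ j / (j.factorial : R))
  rw [Nat.factorial_succ, Nat.cast_mul, pow_succ]
  push_cast
  field_simp

section Recursion

variable {V β R : Type*} [CommRing R]

section Global

variable [Fintype V] [Fintype β]

/-- Functoriality of the Boltzmann polynomial in the coefficient ring. [folklore] -/
private theorem map_boltzmann {S : Type*} [CommRing S] (φ : R →+* S) (D : ℕ) (s t : β → V)
    (f : V → ℕ → R) (g : β → ℕ → R) :
    MvPolynomial.map φ (boltzmann D s t f g) =
      boltzmann D s t (fun x j => φ (f x j)) (fun b j => φ (g b j)) := by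
  unfold boltzmann siteFactor bondFactor
  simp only [map_mul, map_prod, map_sum, map_pow, map_C, map_X]

/-- Functoriality of `Z` in the coefficient ring. [folklore] -/
private theorem map_Z {S : Type*} [CommRing S] (φ : R →+* S) (D : ℕ) (s t : β → V)
    (f : V → ℕ → R) (g : β → ℕ → R) (c : V →₀ ℕ) :
    φ (Z D s t f g c) = Z D s t (fun x j => φ (f x j)) (fun b j => φ (g b j)) c := by
  unfold Z
  rw [← coeff_map, map_boltzmann]

/-- `Z(0) = 1`: with no capacity only the constant terms `F_x(0) = B_b(0) = 1` contribute.
[cite: HeilmannLieb1972, (4.19)] -/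
theorem Z_zero {D : ℕ} {s t : β → V} {f : V → ℕ → R} {g : β → ℕ → R}
    (hf : ∀ x, f x 0 = 1) (hg : ∀ b, g b 0 = 1) : Z D s t f g 0 = 1 := by
  unfold Z boltzmann
  rw [← constantCoeff_eq, map_mul, map_prod, map_prod]
  have hs : ∀ x, constantCoeff (siteFactor D f x) = 1 := by
    intro x
    unfold siteFactor
    rw [map_sum, Finset.sum_eq_single 0]
    · simp [hf x]
    · intro j _ hj
      simp [constantCoeff_X, zero_pow hj]
    · simp
  have hb : ∀ b, constantCoeff (bondFactor D s t g b) = 1 := by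
    intro b
    unfold bondFactor
    rw [map_sum, Finset.sum_eq_single 0]
    · simp [hg b]
    · intro j _ hj
      simp [constantCoeff_X, zero_pow hj]
    · simp
  simp [hs, hb]

end Global

section Local

/-- `σ_z∂_z` kills the site factor of a site `x ≠ z`. [folklore] -/
private theorem euler_siteFactor_of_ne {z x : V} (hx : z ≠ x) (D : ℕ) (f : V → ℕ → R) :
    euler z (siteFactor D f x) = 0 := by
  unfold siteFactor
  rw [euler_sum]
  refine Finset.sum_eq_zero fun j _ => ?_
  rw [euler_C_mul, euler_X_pow, Finsupp.single_eq_of_ne hx, Nat.cast_zero, C_0, zero_mul,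
    mul_zero]

/-- **`σ_z∂_z F_z(σ_z) = a_z σ_z F_z(σ_z)` modulo `σ_z^{D+1}`** for exponential Taylor data
(`j e_j = a e_{j-1}`). [cite: SalmhoferSeiler1991, (3.46)] -/
private theorem euler_siteFactor_self {D : ℕ} {f : V → ℕ → R} {a : V → R} (z : V)
    (hf : IsExpData (a z) (f z)) :
    ∃ h, HighDeg D z h ∧
      euler z (siteFactor D f z) = C (a z) * X z * siteFactor D f z + h := by
  refine ⟨-(C (a z * f z D) * X z ^ (D + 1)), ?_, ?_⟩
  · have : -(C (a z * f z D) * X z ^ (D + 1)) =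
        X z ^ (D + 1) * (-C (a z * f z D) : MvPolynomial V R) := by ring
    rw [this]
    exact HighDeg.X_pow_mul D z _
  · unfold siteFactor
    rw [euler_sum]
    -- left side: `∑_{j ≤ D} j f_j σ^j`, peel off `j = 0`
    rw [Finset.sum_range_succ' (fun j => euler z (C (f z j) * X z ^ j))]
    rw [Finset.mul_sum, Finset.sum_range_succ (fun j => C (a z) * X z * (C (f z j) * X z ^ j))]
    have h0 : euler z (C (f z 0) * X z ^ 0) = 0 := by
      rw [euler_C_mul, euler_X_pow, Finsupp.single_eq_same, Nat.cast_zero, C_0, zero_mul, mul_zero]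
    rw [h0, add_zero]
    have hterm : ∀ j : ℕ, euler z (C (f z (j + 1)) * X z ^ (j + 1)) =
        C (a z) * X z * (C (f z j) * X z ^ j) := by
      intro j
      rw [euler_C_mul, euler_X_pow, Finsupp.single_eq_same]
      have hcj : f z (j + 1) * ((j + 1 : ℕ) : R) = a z * f z j := by
        rw [mul_comm]; push_cast; exact hf.2 j
      calc C (f z (j + 1)) * (C (((j + 1 : ℕ) : ℕ) : R) * X z ^ (j + 1))
          = C (f z (j + 1) * ((j + 1 : ℕ) : R)) * X z ^ (j + 1) := by rw [map_mul]; ring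
        _ = C (a z * f z j) * X z ^ (j + 1) := by rw [hcj]
        _ = C (a z) * X z * (C (f z j) * X z ^ j) := by rw [map_mul, pow_succ]; ring
    simp_rw [hterm]
    rw [map_mul, pow_succ]
    ring

variable [DecidableEq V]

/-- **`σ_z∂_z B_b = κ_b(z) w_b σ_{s b}σ_{t b} B_b` modulo `σ_z^{D+1}`**, where `κ_b(z) ∈ {0,1,2}`
counts how often `z` is an end point of `b` (`j e_j = w e_{j-1}` for exponential Taylor data).
[cite: SalmhoferSeiler1991, (3.46)] -/
private theorem euler_bondFactor {D : ℕ} {s t : β → V} {g : β → ℕ → R} {w : β → R} (z : V)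
    (b : β) (hg : IsExpData (w b) (g b)) :
    ∃ h, HighDeg D z h ∧
      euler z (bondFactor D s t g b) =
        C (((if s b = z then 1 else 0) + (if t b = z then 1 else 0) : ℕ) : R) * C (w b) *
            (X (s b) * X (t b)) * bondFactor D s t g b + h := by
  classical
  set κ : ℕ := (if s b = z then 1 else 0) + (if t b = z then 1 else 0) with hκ
  set u : MvPolynomial V R := X (s b) * X (t b) with hu
  have hdeg : ∀ j : ℕ, ((Finsupp.single (s b) j + Finsupp.single (t b) j) z : ℕ) = j * κ := by
    intro j
    rw [Finsupp.add_apply, hκ]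
    by_cases hs : s b = z <;> by_cases ht : t b = z
    · subst hs; rw [ht]; simp [Finsupp.single_eq_same]; ring
    · subst hs; simp [Finsupp.single_eq_same, Finsupp.single_eq_of_ne (Ne.symm ht) , ht]
    · subst ht; simp [Finsupp.single_eq_same, Finsupp.single_eq_of_ne (Ne.symm hs), hs]
    · simp [Finsupp.single_eq_of_ne (Ne.symm hs), Finsupp.single_eq_of_ne (Ne.symm ht), hs, ht]
  refine ⟨-(C (κ : R) * C (w b * g b D) * u ^ (D + 1)), ?_, ?_⟩
  · -- the error term is high (or zero)
    by_cases hs : s b = z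
    · have : -(C (κ : R) * C (w b * g b D) * u ^ (D + 1)) =
          X z ^ (D + 1) * (-(C (κ : R) * C (w b * g b D) * X (t b) ^ (D + 1))) := by
        rw [hu, hs, mul_pow]; ring
      rw [this]; exact HighDeg.X_pow_mul D z _
    · by_cases ht : t b = z
      · have : -(C (κ : R) * C (w b * g b D) * u ^ (D + 1)) =
            X z ^ (D + 1) * (-(C (κ : R) * C (w b * g b D) * X (s b) ^ (D + 1))) := by
          rw [hu, ht, mul_pow]; ring
        rw [this]; exact HighDeg.X_pow_mul D z _
      · have hκ0 : κ = 0 := by rw [hκ, if_neg hs, if_neg ht]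
        rw [hκ0, Nat.cast_zero, C_0, zero_mul, zero_mul, neg_zero]
        exact HighDeg.zero D z
  · unfold bondFactor
    rw [← hu, euler_sum]
    rw [Finset.sum_range_succ' (fun j => euler z (C (g b j) * u ^ j))]
    rw [Finset.mul_sum, Finset.sum_range_succ (fun j => C (κ : R) * C (w b) * u * (C (g b j) * u ^ j))]
    have h0 : euler z (C (g b 0) * u ^ 0) = 0 := by
      rw [euler_C_mul, hu, euler_XX_pow, hdeg, zero_mul, Nat.cast_zero, C_0, zero_mul, mul_zero]
    rw [h0, add_zero]
    have hterm : ∀ j : ℕ, euler z (C (g b (j + 1)) * u ^ (j + 1)) =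
        C (κ : R) * C (w b) * u * (C (g b j) * u ^ j) := by
      intro j
      rw [euler_C_mul, hu, euler_XX_pow, hdeg, ← hu]
      have hcj : g b (j + 1) * (((j + 1) * κ : ℕ) : R) = (κ : R) * (w b * g b j) := by
        rw [← hg.2 j]; push_cast; ring
      calc C (g b (j + 1)) * (C (((j + 1) * κ : ℕ) : R) * u ^ (j + 1))
          = C (g b (j + 1) * (((j + 1) * κ : ℕ) : R)) * u ^ (j + 1) := by rw [map_mul]; ring
        _ = C ((κ : R) * (w b * g b j)) * u ^ (j + 1) := by rw [hcj]
        _ = C (κ : R) * C (w b) * u * (C (g b j) * u ^ j) := by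
          rw [map_mul, map_mul, pow_succ]; ring
    simp_rw [hterm]
    rw [map_mul, pow_succ]
    ring

end Local

variable [Fintype V] [Fintype β] [DecidableEq V]

/-- **`σ_z∂_z` of the Boltzmann polynomial**, modulo `σ_z^{D+1}`:
`σ_z∂_z (∏F ∏B) = (a_z σ_z + ∑_b κ_b(z) w_b σ_{s b}σ_{t b}) ∏F ∏B + H`.
[cite: SalmhoferSeiler1991, (3.44)–(3.46)] -/
private theorem euler_boltzmann {D : ℕ} {s t : β → V} {f : V → ℕ → R} {g : β → ℕ → R}
    {a : V → R} {w : β → R} (hf : ∀ x, IsExpData (a x) (f x)) (hg : ∀ b, IsExpData (w b) (g b))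
    (z : V) :
    ∃ H, HighDeg D z H ∧
      euler z (boltzmann D s t f g) =
        (C (a z) * X z + ∑ b, C (((if s b = z then 1 else 0) + (if t b = z then 1 else 0) : ℕ) : R) *
            C (w b) * (X (s b) * X (t b))) * boltzmann D s t f g + H := by
  classical
  -- sites
  obtain ⟨HS, hHS, hS⟩ := euler_prod_of (D := D) (z := z) (Finset.univ : Finset V)
    (fun x => siteFactor D f x) (fun x => if x = z then C (a z) * X z else 0) (by
      intro x _
      by_cases hx : x = z
      · subst hx
        obtain ⟨h, hh, he⟩ := euler_siteFactor_self (D := D) (f := f) x (hf x)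
        exact ⟨h, hh, by rw [if_pos rfl, he]⟩
      · refine ⟨0, HighDeg.zero D z, ?_⟩
        rw [if_neg hx, euler_siteFactor_of_ne (Ne.symm hx), zero_mul, zero_add])
  -- bonds
  obtain ⟨HB, hHB, hB⟩ := euler_prod_of (D := D) (z := z) (Finset.univ : Finset β)
    (fun b => bondFactor D s t g b)
    (fun b => C (((if s b = z then 1 else 0) + (if t b = z then 1 else 0) : ℕ) : R) * C (w b) *
      (X (s b) * X (t b))) (fun b _ => euler_bondFactor z b (hg b))
  refine ⟨HS * ∏ b, bondFactor D s t g b + (∏ x, siteFactor D f x) * HB,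
    (hHS.mul_right _).add (hHB.mul_left _), ?_⟩
  unfold boltzmann
  rw [euler_mul, hS, hB, Finset.sum_ite_eq' Finset.univ z, if_pos (Finset.mem_univ z)]
  ring

/-- **The monomer–dimer recursion** (Heilmann–Lieb (4.11), `Z_G = x_i Z_{G-i} + ∑_j W(i,j) Z_{G-i-j}`),
pushed down to capacities: for `c_z ≥ 1`,
`c_z Z(c) = a_z Z(c - δ_z) + ∑_b w_b ([s b = z] Z(c - δ_z - δ_{t b}) + [t b = z] Z(c - δ_z - δ_{s b}))`
(terms without remaining capacity are `0`).  This is Salmhofer–Seiler's Schwinger–Dyson equation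
(3.46) for the NJL system read as a relation between monomial expectations.
[cite: HeilmannLieb1972, (4.11) and (4.20)][cite: SalmhoferSeiler1991, (3.46)] -/
theorem rec {D : ℕ} {s t : β → V} {f : V → ℕ → R} {g : β → ℕ → R} {a : V → R} {w : β → R}
    (hf : ∀ x, IsExpData (a x) (f x)) (hg : ∀ b, IsExpData (w b) (g b))
    {c : V →₀ ℕ} (hc : ∀ x, c x ≤ D) {z : V} (hz : z ∈ c.support) :
    (c z : R) * Z D s t f g c =
      a z * Z D s t f g (c - Finsupp.single z 1) +
        ∑ b, w b * ((if s b = z then Zdrop D s t f g (c - Finsupp.single z 1) (t b) else 0) +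
          (if t b = z then Zdrop D s t f g (c - Finsupp.single z 1) (s b) else 0)) := by
  classical
  obtain ⟨H, hH, hE⟩ := euler_boltzmann (D := D) (s := s) (t := t) hf hg z
  have hcz : c z ≤ D := hc z
  unfold Z
  rw [← coeff_euler, hE, coeff_add, hH.coeff_eq_zero hcz, add_zero, add_mul, coeff_add,
    Finset.sum_mul, coeff_sum]
  congr 1
  · rw [mul_assoc, coeff_C_mul, coeff_X_mul', if_pos hz]
  · refine Finset.sum_congr rfl fun b _ => ?_
    set B := boltzmann D s t f g with hBdef
    set c' := c - Finsupp.single z 1 with hc'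
    have hXz : ∀ q : MvPolynomial V R, coeff c (X z * q) = coeff c' q := fun q => by
      rw [coeff_X_mul', if_pos hz]
    have hdrop : ∀ y, coeff c' (X y * B) = Zdrop D s t f g c' y := fun y => by
      unfold Zdrop Z; rw [coeff_X_mul']
    rw [show C (((if s b = z then 1 else 0) + (if t b = z then 1 else 0) : ℕ) : R) * C (w b) *
        (X (s b) * X (t b)) * B =
        C ((((if s b = z then 1 else 0) + (if t b = z then 1 else 0) : ℕ) : R) * w b) *
          (X (s b) * (X (t b) * B)) by rw [map_mul]; ring, coeff_C_mul]
    by_cases hs : s b = z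
    · by_cases ht : t b = z
      · rw [if_pos hs, if_pos ht, if_pos hs, if_pos ht, hs, ht, hXz, hdrop]
        push_cast; ring
      · rw [if_pos hs, if_neg ht, if_pos hs, if_neg ht, hs, hXz, hdrop]
        push_cast; ring
    · by_cases ht : t b = z
      · rw [if_neg hs, if_pos ht, if_neg hs, if_pos ht, ht, mul_left_comm, hXz, hdrop]
        push_cast; ring
      · rw [if_neg hs, if_neg ht, if_neg hs, if_neg ht]
        push_cast; ring

end Recursion

/-! ### The Heilmann–Lieb theorem: zero-free half planes and the bound on the zeros -/

section Capacity

variable {V : Type*} {D : ℕ}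

/-- Removing one unit of capacity lowers the total capacity by one. [folklore] -/
private theorem degree_sub_single_add_one {c : V →₀ ℕ} {z : V} (hz : z ∈ c.support) :
    (c - Finsupp.single z 1).degree + 1 = c.degree := by
  have hle : Finsupp.single z 1 ≤ c :=
    Finsupp.single_le_iff.2 (Nat.one_le_iff_ne_zero.2 (Finsupp.mem_support_iff.1 hz))
  conv_rhs => rw [← tsub_add_cancel_of_le hle]
  rw [map_add, Finsupp.degree_single]

/-- Removing capacity keeps the bound `c ≤ D`. [folklore] -/
private theorem sub_single_apply_le {c : V →₀ ℕ} (hc : ∀ x, c x ≤ D) (z x : V) :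
    (c - Finsupp.single z 1 : V →₀ ℕ) x ≤ D := by
  rw [Finsupp.tsub_apply]
  exact (Nat.sub_le _ _).trans (hc x)

/-- A proper sub-capacity has smaller total capacity. [folklore] -/
private theorem degree_lt_of_le_of_ne {c d : V →₀ ℕ} (hdc : d ≤ c) (hne : d ≠ c) : d.degree < c.degree := by
  have hcd : c = d + (c - d) := (add_tsub_cancel_of_le hdc).symm
  have hne' : c - d ≠ 0 := by
    intro h
    exact hne (by rw [hcd, h, add_zero])
  have hpos : 0 < (c - d).degree := Nat.pos_of_ne_zero (mt (Finsupp.degree_eq_zero_iff _).1 hne')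
  rw [hcd, map_add]
  omega

end Capacity

section HeilmannLieb

variable {V β : Type*} [Fintype V] [Fintype β] [DecidableEq V]
variable {D : ℕ} {s t : β → V} {f : V → ℕ → ℂ} {g : β → ℕ → ℂ} {a : V → ℂ} {w : β → ℝ}

/-- **Heilmann–Lieb (Theorem 4.6 / Lemma 4.7), capacity form = Salmhofer–Seiler Theorem 3.6.**  For
nonnegative bond weights `w_b ≥ 0` and complex monomer activities with `ε Re a_x > 0` for all `x`
(`ε = ±1`), the partition function `Z(c)` does not vanish, and every ratio
`Z(c - δ_z)/Z(c)` ("`Z_{G-i}/Z_G`") has `ε Re > 0` and modulus `≤ c_z / (ε Re a_z)`.  Proof as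
printed in [HeilmannLieb1972]: induction on the size with the recursion (4.11)/(4.20).
[cite: HeilmannLieb1972, Thm. 4.6 and Lemma 4.7][cite: SalmhoferSeiler1991, Thm. 3.6] -/
theorem heilmannLieb (hf : ∀ x, IsExpData (a x) (f x)) (hg : ∀ b, IsExpData (w b : ℂ) (g b))
    {ε : ℝ} (hε : ε = 1 ∨ ε = -1) (ha : ∀ x, 0 < ε * (a x).re) (hw : ∀ b, 0 ≤ w b)
    (c : V →₀ ℕ) (hc : ∀ x, c x ≤ D) :
    Z D s t f g c ≠ 0 ∧ ∀ z ∈ c.support,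
      0 < ε * (Z D s t f g (c - Finsupp.single z 1) / Z D s t f g c).re ∧
        ‖Z D s t f g (c - Finsupp.single z 1) / Z D s t f g c‖ ≤ c z / (ε * (a z).re) := by
  suffices H : ∀ n (c : V →₀ ℕ), c.degree = n → (∀ x, c x ≤ D) →
      Z D s t f g c ≠ 0 ∧ ∀ z ∈ c.support,
        0 < ε * (Z D s t f g (c - Finsupp.single z 1) / Z D s t f g c).re ∧
          ‖Z D s t f g (c - Finsupp.single z 1) / Z D s t f g c‖ ≤ c z / (ε * (a z).re) from
    H _ c rfl hc
  intro n
  induction n using Nat.strong_induction_on with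
  | _ n ih =>
  intro c hn hc
  have hεabs : ∀ x : ℝ, ε * x ≤ |x| := fun x => by
    rcases hε with h | h <;> subst h <;> simp [le_abs_self, neg_le_abs]
  -- the ratio claim at every `z ∈ supp c`; it also yields `Z(c) ≠ 0`
  have hstep : ∀ z ∈ c.support, Z D s t f g c ≠ 0 ∧
      0 < ε * (Z D s t f g (c - Finsupp.single z 1) / Z D s t f g c).re ∧
        ‖Z D s t f g (c - Finsupp.single z 1) / Z D s t f g c‖ ≤ c z / (ε * (a z).re) := by
    intro z hz
    set c' := c - Finsupp.single z 1 with hc'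
    have hdeg : c'.degree < n := by
      have := degree_sub_single_add_one hz; rw [← hc'] at this; omega
    obtain ⟨hZ', hrat'⟩ := ih _ hdeg c' rfl (sub_single_apply_le hc z)
    have hrec := rec (s := s) (t := t) hf hg hc hz
    set S : ℂ := ∑ b, (w b : ℂ) *
      ((if s b = z then Zdrop D s t f g c' (t b) else 0) +
        (if t b = z then Zdrop D s t f g c' (s b) else 0)) with hS
    set u : ℂ := (c z : ℂ) * Z D s t f g c / Z D s t f g c' with hudef
    have hu : u = a z + S / Z D s t f g c' := by
      rw [hudef, hrec, add_div, mul_div_cancel_right₀ _ hZ']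
    -- every dropped ratio has `ε Re ≥ 0`
    have hdrop : ∀ y, 0 ≤ ε * (Zdrop D s t f g c' y / Z D s t f g c').re := by
      intro y
      unfold Zdrop
      split_ifs with hy
      · exact (hrat' y hy).1.le
      · simp
    have hSre : 0 ≤ ε * (S / Z D s t f g c').re := by
      rw [hS, Finset.sum_div, Complex.re_sum, Finset.mul_sum]
      refine Finset.sum_nonneg fun b _ => ?_
      have h1 : 0 ≤ ε * ((if s b = z then Zdrop D s t f g c' (t b) else 0) / Z D s t f g c').re := by
        split_ifs
        · exact hdrop _
        · simp
      have h2 : 0 ≤ ε * ((if t b = z then Zdrop D s t f g c' (s b) else 0) / Z D s t f g c').re := by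
        split_ifs
        · exact hdrop _
        · simp
      rw [mul_div_assoc, Complex.re_ofReal_mul, add_div, Complex.add_re]
      have := hw b
      nlinarith
    have hue : ε * (a z).re ≤ ε * u.re := by
      rw [hu, Complex.add_re, mul_add]; linarith
    have hupos : 0 < ε * u.re := (ha z).trans_le hue
    have hZc : Z D s t f g c ≠ 0 := by
      intro h0
      rw [hudef, h0, mul_zero, zero_div, Complex.zero_re, mul_zero] at hupos
      exact lt_irrefl _ hupos
    have hcz0 : c z ≠ 0 := Finsupp.mem_support_iff.1 hz
    have hcz : (c z : ℂ) ≠ 0 := by exact_mod_cast hcz0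
    have hu0 : u ≠ 0 := by
      intro h; rw [h, Complex.zero_re, mul_zero] at hupos; exact lt_irrefl _ hupos
    have hratio : Z D s t f g c' / Z D s t f g c = (c z : ℂ) / u := by
      rw [hudef]; field_simp
    have hnormu : ε * (a z).re ≤ ‖u‖ :=
      hue.trans ((hεabs _).trans (Complex.abs_re_le_norm u))
    refine ⟨hZc, ?_, ?_⟩
    · rw [hratio, div_eq_mul_inv, ← Complex.ofReal_natCast, Complex.re_ofReal_mul, Complex.inv_re,
        show ε * ((c z : ℝ) * (u.re / Complex.normSq u)) = (c z : ℝ) * (ε * u.re) / Complex.normSq u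
          by ring]
      exact div_pos (mul_pos (by exact_mod_cast Nat.pos_of_ne_zero hcz0) hupos)
        (Complex.normSq_pos.2 hu0)
    · rw [hratio, norm_div, Complex.norm_natCast]
      exact div_le_div_of_nonneg_left (Nat.cast_nonneg _) (ha z) hnormu
  refine ⟨?_, fun z hz => (hstep z hz).2⟩
  by_cases h0 : c = 0
  · subst h0
    rw [Z_zero (fun x => (hf x).1) (fun b => (hg b).1)]
    exact one_ne_zero
  · obtain ⟨z, hz⟩ := Finsupp.support_nonempty_iff.2 h0
    exact (hstep z hz).1

/-- **Theorem 3.6, `Re m_x > 0`**: the partition function does not vanish when all monomer activities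
have positive real part and the bond weights are nonnegative. [cite: SalmhoferSeiler1991, Thm. 3.6][cite: HeilmannLieb1972, Thm. 4.6] -/
theorem Z_ne_zero_of_re_pos (hf : ∀ x, IsExpData (a x) (f x)) (hg : ∀ b, IsExpData (w b : ℂ) (g b))
    (ha : ∀ x, 0 < (a x).re) (hw : ∀ b, 0 ≤ w b) (c : V →₀ ℕ) (hc : ∀ x, c x ≤ D) :
    Z D s t f g c ≠ 0 :=
  (heilmannLieb hf hg (Or.inl rfl) (fun x => by simpa using ha x) hw c hc).1

/-- **Theorem 3.6, `Re m_x < 0`**: the partition function does not vanish when all monomer activities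
have negative real part and the bond weights are nonnegative. [cite: SalmhoferSeiler1991, Thm. 3.6][cite: HeilmannLieb1972, Thm. 4.6] -/
theorem Z_ne_zero_of_re_neg (hf : ∀ x, IsExpData (a x) (f x)) (hg : ∀ b, IsExpData (w b : ℂ) (g b))
    (ha : ∀ x, (a x).re < 0) (hw : ∀ b, 0 ≤ w b) (c : V →₀ ℕ) (hc : ∀ x, c x ≤ D) :
    Z D s t f g c ≠ 0 :=
  (heilmannLieb hf hg (Or.inr rfl) (fun x => by have := ha x; linarith) hw c hc).1

/-- The weighted number of dimer slots adjacent to the vertex `x` at capacities `c`: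
`W_x(c) = ∑_{b : s b = x} w_b c_{t b} + ∑_{b : t b = x} w_b c_{s b}` — Heilmann–Lieb's
`B₁ = max_i ∑_j W(i,j)` (4.8) / Salmhofer–Seiler's `W = max_x ∑_y w_xy` (3.28) for the graph
`V × {1,…,N}` of Remark 3.4(3). [cite: HeilmannLieb1972, (4.8)][cite: SalmhoferSeiler1991, (3.28)] -/
def weightedDegree (s t : β → V) (w : β → ℝ) (c : V →₀ ℕ) (x : V) : ℝ :=
  ∑ b, w b * ((if s b = x then (c (t b) : ℝ) else 0) + (if t b = x then (c (s b) : ℝ) else 0))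

omit [Fintype V] in
/-- `W_x(c)` is monotone in the capacities. [folklore] -/
private theorem weightedDegree_mono (hw : ∀ b, 0 ≤ w b) {c d : V →₀ ℕ} (h : d ≤ c) (x : V) :
    weightedDegree s t w d x ≤ weightedDegree s t w c x := by
  unfold weightedDegree
  refine Finset.sum_le_sum fun b _ => mul_le_mul_of_nonneg_left ?_ (hw b)
  have h1 : (d (t b) : ℝ) ≤ c (t b) := by exact_mod_cast h (t b)
  have h2 : (d (s b) : ℝ) ≤ c (s b) := by exact_mod_cast h (s b)
  split_ifs <;> linarith

omit [Fintype V] in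
/-- `W_x(c) ≥ 0`. [folklore] -/
private theorem weightedDegree_nonneg (hw : ∀ b, 0 ≤ w b) (c : V →₀ ℕ) (x : V) :
    0 ≤ weightedDegree s t w c x := by
  unfold weightedDegree
  refine Finset.sum_nonneg fun b _ => mul_nonneg (hw b) ?_
  split_ifs <;> positivity

/-- **Heilmann–Lieb's bound on the zeros (Theorem 4.3), capacity form.**  If `w_b ≥ 0` and all
activities satisfy `‖a_x‖ ≥ R > 0` with `R² ≥ 4 W_x(c)` for every `x`, then `Z(c) ≠ 0` and
`‖Z(c - δ_z)/Z(c)‖ ≤ 2 c_z / R`; for the monomer–dimer system: all zeros of `Z_G(x)` satisfy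
`|x| < 2 √B₁` (4.10), in Salmhofer–Seiler's form (3.28).  Proof by the same induction as
Lemma 4.4 of [HeilmannLieb1972]. [cite: HeilmannLieb1972, Thm. 4.3 and Lemma 4.4][cite: SalmhoferSeiler1991, (3.28)] -/
theorem heilmannLieb_rootBound (hf : ∀ x, IsExpData (a x) (f x))
    (hg : ∀ b, IsExpData (w b : ℂ) (g b)) (hw : ∀ b, 0 ≤ w b) {R : ℝ} (hR : 0 < R)
    (haR : ∀ x, R ≤ ‖a x‖) (c : V →₀ ℕ) (hc : ∀ x, c x ≤ D)
    (hW : ∀ x, 4 * weightedDegree s t w c x ≤ R ^ 2) :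
    Z D s t f g c ≠ 0 ∧ ∀ z ∈ c.support,
      ‖Z D s t f g (c - Finsupp.single z 1) / Z D s t f g c‖ ≤ 2 * c z / R := by
  suffices H : ∀ n (c : V →₀ ℕ), c.degree = n → (∀ x, c x ≤ D) →
      (∀ x, 4 * weightedDegree s t w c x ≤ R ^ 2) →
      Z D s t f g c ≠ 0 ∧ ∀ z ∈ c.support,
        ‖Z D s t f g (c - Finsupp.single z 1) / Z D s t f g c‖ ≤ 2 * c z / R from H _ c rfl hc hW
  intro n
  induction n using Nat.strong_induction_on with
  | _ n ih =>
  intro c hn hc hW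
  have hstep : ∀ z ∈ c.support, Z D s t f g c ≠ 0 ∧
      ‖Z D s t f g (c - Finsupp.single z 1) / Z D s t f g c‖ ≤ 2 * c z / R := by
    intro z hz
    set c' := c - Finsupp.single z 1 with hc'
    have hdeg : c'.degree < n := by
      have := degree_sub_single_add_one hz; rw [← hc'] at this; omega
    have hc'le : c' ≤ c := tsub_le_self
    obtain ⟨hZ', hrat'⟩ := ih _ hdeg c' rfl (sub_single_apply_le hc z)
      fun x => (mul_le_mul_of_nonneg_left (weightedDegree_mono hw hc'le x) (by norm_num)).trans (hW x)
    have hrec := rec (s := s) (t := t) hf hg hc hz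
    set S : ℂ := ∑ b, (w b : ℂ) *
      ((if s b = z then Zdrop D s t f g c' (t b) else 0) +
        (if t b = z then Zdrop D s t f g c' (s b) else 0)) with hS
    set u : ℂ := (c z : ℂ) * Z D s t f g c / Z D s t f g c' with hudef
    have hu : u = a z + S / Z D s t f g c' := by
      rw [hudef, hrec, add_div, mul_div_cancel_right₀ _ hZ']
    -- every dropped ratio has modulus `≤ 2 c'_y / R`
    have hdrop : ∀ y, ‖Zdrop D s t f g c' y / Z D s t f g c'‖ ≤ 2 * c' y / R := by
      intro y
      unfold Zdrop
      split_ifs with hy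
      · exact (hrat' y hy)
      · rw [zero_div, norm_zero]; positivity
    have hSnorm : ‖S / Z D s t f g c'‖ ≤ 2 / R * weightedDegree s t w c' z := by
      rw [hS, Finset.sum_div, weightedDegree, Finset.mul_sum]
      refine (norm_sum_le _ _).trans (Finset.sum_le_sum fun b _ => ?_)
      rw [mul_div_assoc, norm_mul, Complex.norm_real, Real.norm_of_nonneg (hw b), add_div]
      have h1 : ‖(if s b = z then Zdrop D s t f g c' (t b) else 0) / Z D s t f g c'‖ ≤
          if s b = z then 2 * (c' (t b) : ℝ) / R else 0 := by
        split_ifs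
        · exact hdrop _
        · simp
      have h2 : ‖(if t b = z then Zdrop D s t f g c' (s b) else 0) / Z D s t f g c'‖ ≤
          if t b = z then 2 * (c' (s b) : ℝ) / R else 0 := by
        split_ifs
        · exact hdrop _
        · simp
      calc w b * ‖(if s b = z then Zdrop D s t f g c' (t b) else 0) / Z D s t f g c' +
              (if t b = z then Zdrop D s t f g c' (s b) else 0) / Z D s t f g c'‖
          ≤ w b * ((if s b = z then 2 * (c' (t b) : ℝ) / R else 0) +
              (if t b = z then 2 * (c' (s b) : ℝ) / R else 0)) :=
            mul_le_mul_of_nonneg_left ((norm_add_le _ _).trans (add_le_add h1 h2)) (hw b)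
        _ = 2 / R * (w b * ((if s b = z then (c' (t b) : ℝ) else 0) +
              (if t b = z then (c' (s b) : ℝ) else 0))) := by
            split_ifs <;> ring
    have hWz : 2 / R * weightedDegree s t w c' z ≤ R / 2 := by
      have h1 : weightedDegree s t w c' z ≤ R ^ 2 / 4 := by
        have := (mul_le_mul_of_nonneg_left (weightedDegree_mono hw hc'le z)
          (by norm_num : (0:ℝ) ≤ 4)).trans (hW z)
        linarith
      calc 2 / R * weightedDegree s t w c' z ≤ 2 / R * (R ^ 2 / 4) :=
            mul_le_mul_of_nonneg_left h1 (by positivity)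
        _ = R * (R / 2) / R := by ring
        _ = R / 2 := mul_div_cancel_left₀ _ hR.ne'
    have hnormu : R / 2 ≤ ‖u‖ := by
      have : ‖a z‖ - ‖S / Z D s t f g c'‖ ≤ ‖u‖ := by
        rw [hu]; exact norm_sub_le_norm_add _ _ |>.trans' le_rfl
      linarith [haR z]
    have hu0 : u ≠ 0 := by
      intro h; rw [h, norm_zero] at hnormu; linarith
    have hZc : Z D s t f g c ≠ 0 := by
      intro h0
      apply hu0
      rw [hudef, h0, mul_zero, zero_div]
    have hcz0 : c z ≠ 0 := Finsupp.mem_support_iff.1 hz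
    have hcz : (c z : ℂ) ≠ 0 := by exact_mod_cast hcz0
    have hratio : Z D s t f g c' / Z D s t f g c = (c z : ℂ) / u := by
      rw [hudef]; field_simp
    refine ⟨hZc, ?_⟩
    rw [hratio, norm_div, Complex.norm_natCast]
    calc (c z : ℝ) / ‖u‖ ≤ (c z : ℝ) / (R / 2) :=
          div_le_div_of_nonneg_left (Nat.cast_nonneg _) (by positivity) hnormu
      _ = 2 * c z / R := by rw [div_div_eq_mul_div]; ring
  refine ⟨?_, fun z hz => (hstep z hz).2⟩
  by_cases h0 : c = 0
  · subst h0
    rw [Z_zero (fun x => (hf x).1) (fun b => (hg b).1)]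
    exact one_ne_zero
  · obtain ⟨z, hz⟩ := Finsupp.support_nonempty_iff.2 h0
    exact (hstep z hz).1

/-- Telescoping of one-step ratio bounds: if along every admissible capacity `Z ≠ 0` and
`‖Z(c - δ_z)/Z(c)‖ ≤ K`, then `‖Z(d)/Z(c)‖ ≤ K^{|c| - |d|}` for `d ≤ c`. [folklore] -/
private theorem norm_div_le_pow_of_step {Zf : (V →₀ ℕ) → ℂ} {P : (V →₀ ℕ) → Prop}
    (hP : ∀ c z, P c → z ∈ c.support → P (c - Finsupp.single z 1)) {K : ℝ} (hK : 0 ≤ K)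
    (hstep : ∀ c, P c → Zf c ≠ 0 ∧ ∀ z ∈ c.support, ‖Zf (c - Finsupp.single z 1) / Zf c‖ ≤ K)
    {c d : V →₀ ℕ} (hdc : d ≤ c) (hPc : P c) :
    ‖Zf d / Zf c‖ ≤ K ^ (c.degree - d.degree) := by
  suffices H : ∀ k (c : V →₀ ℕ), c.degree - d.degree = k → d ≤ c → P c →
      ‖Zf d / Zf c‖ ≤ K ^ (c.degree - d.degree) from H _ c rfl hdc hPc
  intro k
  induction k with
  | zero =>
    intro c hk hdc hPc
    have hdc' : d = c := by
      by_contra hne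
      have := degree_lt_of_le_of_ne hdc hne
      omega
    subst hdc'
    rw [hk, pow_zero, div_self (hstep d hPc).1, norm_one]
  | succ k ih =>
    intro c hk hdc hPc
    have hne : d ≠ c := by rintro rfl; simp at hk
    -- a site where `d` has spare capacity
    obtain ⟨z, hz⟩ : ∃ z, d z < c z := by
      by_contra h
      exact hne (le_antisymm hdc fun x => not_lt.1 (not_exists.1 h x))
    have hzs : z ∈ c.support := Finsupp.mem_support_iff.2 (by omega)
    set c' := c - Finsupp.single z 1 with hc'
    have hdc'' : d ≤ c' := by
      intro x
      rw [hc', Finsupp.tsub_apply]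
      by_cases hx : x = z
      · subst hx; rw [Finsupp.single_eq_same]; omega
      · rw [Finsupp.single_eq_of_ne hx]; simpa using hdc x
    have hdeg := degree_sub_single_add_one hzs
    rw [← hc'] at hdeg
    have hk' : c'.degree - d.degree = k := by omega
    obtain ⟨hZc, hzc⟩ := hstep c hPc
    have hZc' : Zf c' ≠ 0 := (hstep c' (hP c z hPc hzs)).1
    have h1 := ih c' hk' hdc'' (hP c z hPc hzs)
    have h2 := hzc z hzs
    rw [hk'] at h1
    rw [hk, show Zf d / Zf c = (Zf d / Zf c') * (Zf c' / Zf c) by field_simp, norm_mul, pow_succ]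
    exact mul_le_mul h1 h2 (norm_nonneg _) (pow_nonneg hK _)

/-- **Uniform bounds on correlation ratios, `ε Re m_x ≥ ρ > 0`**: `‖Z(d)/Z(c)‖ ≤ (D/ρ)^{|c|-|d|}` for
`d ≤ c ≤ D` — for the monomer–dimer system these ratios are the correlation functions
`Z_{G-S}/Z_G`, bounded by a negative power of `|Re m|` uniformly in the graph (the constant of
the Erratum to Thm. 3.11). [cite: HeilmannLieb1972, Lemma 4.7][cite: SalmhoferSeiler1992Erratum, (5)] -/
theorem norm_Z_div_Z_le_of_re (hf : ∀ x, IsExpData (a x) (f x)) (hg : ∀ b, IsExpData (w b : ℂ) (g b))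
    {ε : ℝ} (hε : ε = 1 ∨ ε = -1) {ρ : ℝ} (hρ : 0 < ρ) (ha : ∀ x, ρ ≤ ε * (a x).re)
    (hw : ∀ b, 0 ≤ w b) {c d : V →₀ ℕ} (hdc : d ≤ c) (hc : ∀ x, c x ≤ D) :
    ‖Z D s t f g d / Z D s t f g c‖ ≤ (D / ρ) ^ (c.degree - d.degree) := by
  refine norm_div_le_pow_of_step (P := fun c => ∀ x, c x ≤ D)
    (fun c z hc _ => sub_single_apply_le hc z) (by positivity) (fun c hc => ?_) hdc hc
  obtain ⟨hZ, hr⟩ := heilmannLieb hf hg hε (fun x => hρ.trans_le (ha x)) hw c hc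
  refine ⟨hZ, fun z hz => (hr z hz).2.trans ?_⟩
  calc (c z : ℝ) / (ε * (a z).re) ≤ D / (ε * (a z).re) :=
        div_le_div_of_nonneg_right (by exact_mod_cast hc z) (hρ.le.trans (ha z))
    _ ≤ D / ρ := div_le_div_of_nonneg_left (Nat.cast_nonneg _) hρ (ha z)

/-- **Uniform bounds on correlation ratios, `‖m_x‖ ≥ R ≥ 2√W`**: `‖Z(d)/Z(c)‖ ≤ (2D/R)^{|c|-|d|}` for
`d ≤ c ≤ D` when `R² ≥ 4 W_x(c)` for all `x`. [cite: HeilmannLieb1972, Thm. 4.3 and Lemma 4.4] -/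
theorem norm_Z_div_Z_le_of_norm (hf : ∀ x, IsExpData (a x) (f x))
    (hg : ∀ b, IsExpData (w b : ℂ) (g b)) (hw : ∀ b, 0 ≤ w b) {R : ℝ} (hR : 0 < R)
    (haR : ∀ x, R ≤ ‖a x‖) {c d : V →₀ ℕ} (hdc : d ≤ c) (hc : ∀ x, c x ≤ D)
    (hW : ∀ x, 4 * weightedDegree s t w c x ≤ R ^ 2) :
    ‖Z D s t f g d / Z D s t f g c‖ ≤ (2 * D / R) ^ (c.degree - d.degree) := by
  refine norm_div_le_pow_of_step
    (P := fun c => (∀ x, c x ≤ D) ∧ ∀ x, 4 * weightedDegree s t w c x ≤ R ^ 2)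
    (fun c z hc _ => ⟨sub_single_apply_le hc.1 z, fun x =>
      (mul_le_mul_of_nonneg_left (weightedDegree_mono hw tsub_le_self x) (by norm_num)).trans
        (hc.2 x)⟩)
    (by positivity) (fun c hc => ?_) hdc ⟨hc, hW⟩
  obtain ⟨hZ, hr⟩ := heilmannLieb_rootBound hf hg hw hR haR c hc.1 hc.2
  refine ⟨hZ, fun z hz => (hr z hz).trans ?_⟩
  rw [mul_div_assoc, mul_div_assoc]
  exact mul_le_mul_of_nonneg_left
    (div_le_div_of_nonneg_right (by exact_mod_cast hc.1 z) hR.le) (by norm_num)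

end HeilmannLieb

end MonomerDimer

/-! ## Part II.  The NJL system of Salmhofer–Seiler at complex mass -/

namespace ComplexSpin

open MonomerDimer

open Literature.Probability.LatticeModels (TorusSite)

variable {ν L : ℕ}

/-- The source `x` of the link `(x, μ) ↦ (x, x + e_μ)` of the torus (bonds enumerated as in (2.21)).
[cite: SalmhoferSeiler1991, (2.21) and Def. 3.3(3)] -/
def linkSrc (b : TorusSite ν L × Fin ν) : TorusSite ν L := b.1

/-- The target `x + e_μ` of the link `(x, μ)` of the torus. [cite: SalmhoferSeiler1991, (2.21) and Def. 3.3(3)] -/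
def linkTgt (b : TorusSite ν L × Fin ν) : TorusSite ν L := b.1 + Pi.single b.2 1

/-- The Taylor data `(2Nm)^j/j!` of the NJL site weight `F(z) = e^{2Nmz}` at COMPLEX mass `m`.
[cite: SalmhoferSeiler1991, Def. 3.3(1) and (3.58)] -/
def njlSiteData (N : ℕ) (m : ℂ) : TorusSite ν L → ℕ → ℂ :=
  fun _ j => (2 * N * m) ^ j / (Nat.factorial j : ℂ)

/-- The Taylor data `a_j = N^j/j!` of the NJL bond weight `B(t) = e^{Nt}` (`w₁ = 1`), i.e. the
tree's `njlBondCoeff` read in `ℂ`. [cite: SalmhoferSeiler1991, Def. 3.3(1)] -/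
def njlBondData (N : ℕ) : TorusSite ν L × Fin ν → ℕ → ℂ :=
  fun _ j => ((njlBondCoeff N j : ℝ) : ℂ)

variable [NeZero L]

/-- The Boltzmann polynomial of the NJL system on the torus at complex mass `m`. [cite: SalmhoferSeiler1991, Def. 3.3(1),(3)] -/
def njlBoltzmannC (N : ℕ) (m : ℂ) : FieldAlg ν L :=
  MonomerDimer.boltzmann N linkSrc linkTgt (njlSiteData N m) (njlBondData (ν := ν) (L := L) N)

/-- `[Φ]_Λ(m)`: the unnormalised expectation of the NJL system at complex mass `m` (coefficient of
`∏_x σ_x^N`, Remark 3.2). [cite: SalmhoferSeiler1991, (3.1)–(3.2) and Remark 3.2] -/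
def njlBracketC (N : ℕ) (m : ℂ) (Φ : FieldAlg ν L) : ℂ :=
  coeff (topExponent N) (Φ * njlBoltzmannC N m)

/-- `Z_Λ(m)`: the NJL partition function at complex mass `m` — a polynomial in `m` whose zeros are
the subject of Theorem 3.6 / (3.28). [cite: SalmhoferSeiler1991, (3.1) and Thm. 3.6] -/
def njlPartitionFunctionC (N : ℕ) (m : ℂ) : ℂ :=
  njlBracketC (ν := ν) (L := L) N m 1

/-- `⟨Φ⟩_Λ(m) = [Φ]_Λ(m) / Z_Λ(m)` at complex mass (junk `0` where `Z_Λ(m) = 0`). [cite: SalmhoferSeiler1991, (3.2)] -/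
def njlExpectC (N : ℕ) (m : ℂ) (Φ : FieldAlg ν L) : ℂ :=
  njlBracketC N m Φ / njlPartitionFunctionC (ν := ν) (L := L) N m

/-! ### Consistency with the tree's real-mass NJL system -/

/-- At real mass the complex-mass Boltzmann polynomial is the tree's `boltzmannC` with NJL data. [cite: SalmhoferSeiler1991, Def. 3.3(1)] -/
theorem njlBoltzmannC_ofReal (N : ℕ) (m : ℝ) :
    njlBoltzmannC (ν := ν) (L := L) N (m : ℂ) =
      boltzmannC N (fun j => (2 * N * m) ^ j / (Nat.factorial j : ℝ)) (njlBondCoeff N) := by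
  have hs : ∀ x : TorusSite ν L, MonomerDimer.siteFactor N (njlSiteData N (m : ℂ)) x =
      siteWeightC N (fun j => (2 * N * m) ^ j / (Nat.factorial j : ℝ)) x := by
    intro x
    unfold MonomerDimer.siteFactor siteWeightC njlSiteData
    refine Finset.sum_congr rfl fun j _ => ?_
    simp only [Complex.ofReal_div, Complex.ofReal_pow, Complex.ofReal_mul, Complex.ofReal_natCast,
      Complex.ofReal_ofNat]
  have hb : ∀ b : TorusSite ν L × Fin ν,
      MonomerDimer.bondFactor N linkSrc linkTgt (njlBondData (ν := ν) (L := L) N) b =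
        bondWeightC N (njlBondCoeff N) b.1 (b.1 + Pi.single b.2 1) := fun b => rfl
  unfold njlBoltzmannC MonomerDimer.boltzmann boltzmannC
  rw [Fintype.prod_prod_type]
  simp_rw [hs, hb]

/-- At real mass `[Φ]_Λ(m)` is the tree's real bracket of the NJL system. [cite: SalmhoferSeiler1991, (3.1)–(3.2)] -/
theorem njlBracketC_ofReal (N : ℕ) (m : ℝ) (Φ : MvPolynomial (TorusSite ν L) ℝ) :
    njlBracketC N (m : ℂ) (MvPolynomial.map Complex.ofRealHom Φ) =
      (bracket N m (njlBondCoeff N) Φ : ℂ) := by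
  rw [njlBracketC, njlBoltzmannC_ofReal, bracket_eq_bracketC, bracketC]

/-- At real mass `Z_Λ(m)` is the tree's `partitionFunction N m njlBondCoeff`. [cite: SalmhoferSeiler1991, (3.1)] -/
theorem njlPartitionFunctionC_ofReal (N : ℕ) (m : ℝ) :
    njlPartitionFunctionC (ν := ν) (L := L) N (m : ℂ) =
      (partitionFunction (ν := ν) (L := L) N m (njlBondCoeff N) : ℂ) := by
  rw [njlPartitionFunctionC, partitionFunction, ← njlBracketC_ofReal, map_one]

/-- At real mass `⟨Φ⟩_Λ(m)` is the tree's real expectation of the NJL system. [cite: SalmhoferSeiler1991, (3.2)] -/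
theorem njlExpectC_ofReal (N : ℕ) (m : ℝ) (Φ : MvPolynomial (TorusSite ν L) ℝ) :
    njlExpectC N (m : ℂ) (MvPolynomial.map Complex.ofRealHom Φ) =
      (expect N m (njlBondCoeff N) Φ : ℂ) := by
  rw [njlExpectC, expect, njlBracketC_ofReal, njlPartitionFunctionC_ofReal, Complex.ofReal_div]

/-- Monomial brackets are capacity partition functions: `[σ^l]_Λ(m) = Z(N - l)` (and `0` if some
`l_x > N`, Remark 3.2). [cite: SalmhoferSeiler1991, Remark 3.2 and (3.30)] -/
theorem njlBracketC_monomial (N : ℕ) (m : ℂ) (l : TorusSite ν L →₀ ℕ) :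
    njlBracketC N m (monomial l 1) =
      if l ≤ topExponent N then
        MonomerDimer.Z N linkSrc linkTgt (njlSiteData N m) (njlBondData (ν := ν) (L := L) N)
          (topExponent N - l)
      else 0 := by
  unfold njlBracketC MonomerDimer.Z njlBoltzmannC
  rw [coeff_monomial_mul']
  split_ifs <;> simp

/-- `Z_Λ(m) = Z(N, …, N)`. [cite: SalmhoferSeiler1991, (3.1)] -/
theorem njlPartitionFunctionC_eq_Z (N : ℕ) (m : ℂ) :
    njlPartitionFunctionC (ν := ν) (L := L) N m =
      MonomerDimer.Z N linkSrc linkTgt (njlSiteData N m) (njlBondData (ν := ν) (L := L) N)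
        (topExponent N) := by
  unfold njlPartitionFunctionC njlBracketC MonomerDimer.Z njlBoltzmannC
  rw [one_mul]

omit [NeZero L] in
/-- The NJL site data are exponential Taylor data with activity `2Nm`. [cite: SalmhoferSeiler1991, (3.58)] -/
theorem isExpData_njlSiteData (N : ℕ) (m : ℂ) (x : TorusSite ν L) :
    IsExpData (2 * N * m) (njlSiteData N m x) :=
  isExpData_pow_div_factorial _

omit [NeZero L] in
/-- The NJL bond data are `N^j/j!` read in `ℂ`. [cite: SalmhoferSeiler1991, Def. 3.3(1)] -/
theorem njlBondData_eq (N : ℕ) (b : TorusSite ν L × Fin ν) :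
    njlBondData N b = fun j => (N : ℂ) ^ j / (Nat.factorial j : ℂ) := by
  funext j
  simp [njlBondData, njlBondCoeff]

omit [NeZero L] in
/-- The NJL bond data are exponential Taylor data with weight `N` (`B = e^{Nt}`). [cite: SalmhoferSeiler1991, Def. 3.3(1)] -/
theorem isExpData_njlBondData (N : ℕ) (b : TorusSite ν L × Fin ν) :
    IsExpData (((fun _ : TorusSite ν L × Fin ν => (N : ℝ)) b : ℝ) : ℂ) (njlBondData N b) := by
  rw [njlBondData_eq, Complex.ofReal_natCast]
  exact isExpData_pow_div_factorial _

/-- `Re (2Nm) = 2N Re m`. [folklore] -/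
private theorem re_two_mul_natCast_mul (N : ℕ) (m : ℂ) : ((2 : ℂ) * N * m).re = 2 * N * m.re := by
  simp [Complex.mul_re]

/-- `‖2Nm‖ = 2N ‖m‖`. [folklore] -/
private theorem norm_two_mul_natCast_mul (N : ℕ) (m : ℂ) : ‖(2 : ℂ) * N * m‖ = 2 * N * ‖m‖ := by
  simp

/-- For `N = 0` the top exponent is `0` and `Z_Λ = 1`. [folklore] -/
private theorem njl_Z_topExponent_zero (m : ℂ) :
    MonomerDimer.Z 0 linkSrc linkTgt (njlSiteData 0 m) (njlBondData (ν := ν) (L := L) 0)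
      (topExponent 0) = 1 := by
  have h0 : topExponent (ν := ν) (L := L) 0 = 0 := by
    ext x; rw [topExponent_apply']; rfl
  rw [h0]
  exact Z_zero (fun x => (isExpData_njlSiteData 0 m x).1) (fun b => (isExpData_njlBondData 0 b).1)

/-! ### Theorem 3.6 for the NJL system: `Z_Λ(m) ≠ 0` off the imaginary axis -/

/-- **Theorem 3.6 (Salmhofer–Seiler) for the NJL system on the torus**: `Z_Λ(m) ≠ 0` whenever
`Re m ≠ 0` — all zeros of the finite-volume NJL partition function are purely imaginary
(a Lee–Yang theorem in the mass), for every `N`, `ν`, `L`. [cite: SalmhoferSeiler1991, Thm. 3.6][cite: HeilmannLieb1972, Thm. 4.6] -/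
theorem njlPartitionFunctionC_ne_zero_of_re_ne_zero (N : ℕ) {m : ℂ} (hm : m.re ≠ 0) :
    njlPartitionFunctionC (ν := ν) (L := L) N m ≠ 0 := by
  rw [njlPartitionFunctionC_eq_Z]
  rcases Nat.eq_zero_or_pos N with h0 | hN
  · subst h0
    rw [njl_Z_topExponent_zero]
    exact one_ne_zero
  · set ε : ℝ := if 0 < m.re then 1 else -1 with hεdef
    have hε : ε = 1 ∨ ε = -1 := by
      by_cases h : 0 < m.re
      · exact Or.inl (if_pos h)
      · exact Or.inr (if_neg h)
    have hεm : 0 < ε * m.re := by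
      by_cases h : 0 < m.re
      · rw [hεdef, if_pos h, one_mul]; exact h
      · rw [hεdef, if_neg h]
        have : m.re < 0 := lt_of_le_of_ne (not_lt.1 h) hm
        linarith
    have hN' : (0 : ℝ) < N := by exact_mod_cast hN
    refine (heilmannLieb (w := fun _ => (N : ℝ)) (fun x => isExpData_njlSiteData N m x)
      (fun b => isExpData_njlBondData N b) hε (fun x => ?_) (fun _ => Nat.cast_nonneg N) _
      (fun x => (topExponent_apply' N x).le)).1
    rw [re_two_mul_natCast_mul]
    nlinarith

/-- **Corollary (real mass)**: the tree's NJL partition function `partitionFunction N m njlBondCoeff`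
does not vanish for real `m ≠ 0`, in every volume. [cite: SalmhoferSeiler1991, Thm. 3.6 and Cor. 3.9] -/
theorem njl_partitionFunction_ne_zero (N : ℕ) {m : ℝ} (hm : m ≠ 0) :
    partitionFunction (ν := ν) (L := L) N m (njlBondCoeff N) ≠ 0 := by
  have h := njlPartitionFunctionC_ne_zero_of_re_ne_zero (ν := ν) (L := L) N (m := (m : ℂ))
    (by rwa [Complex.ofReal_re])
  rwa [njlPartitionFunctionC_ofReal, Complex.ofReal_ne_zero] at h

/-! ### The bound (3.28) on the zeros -/

omit [NeZero L] in
/-- The weighted degree of the NJL system: every site meets `2ν` links of weight `N` and every site has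
capacity `≤ N`, so `W_x(c) ≤ 2νN²` (Salmhofer–Seiler: "`W = 2νN` does not depend on `|Λ|`", in
their normalisation of the graph `Λ × {1,…,N}`). [cite: SalmhoferSeiler1991, (3.28)] -/
theorem njl_weightedDegree_le [Fintype (TorusSite ν L)] (N : ℕ) {c : TorusSite ν L →₀ ℕ}
    (hc : ∀ x, c x ≤ N) (x : TorusSite ν L) :
    weightedDegree linkSrc linkTgt (fun _ => (N : ℝ)) c x ≤ 2 * ν * (N : ℝ) ^ 2 := by
  unfold weightedDegree linkSrc linkTgt
  rw [Fintype.sum_prod_type]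
  calc ∑ y : TorusSite ν L, ∑ μ : Fin ν, (N : ℝ) *
        ((if y = x then (c (y + Pi.single μ 1) : ℝ) else 0) +
          (if y + Pi.single μ 1 = x then (c y : ℝ) else 0))
      ≤ ∑ y : TorusSite ν L, ∑ μ : Fin ν, (N : ℝ) *
        ((if y = x then (N : ℝ) else 0) + (if y = x - Pi.single μ 1 then (N : ℝ) else 0)) := by
        refine Finset.sum_le_sum fun y _ => Finset.sum_le_sum fun μ _ =>
          mul_le_mul_of_nonneg_left (add_le_add ?_ ?_) (Nat.cast_nonneg N)
        · split_ifs
          · exact_mod_cast hc _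
          · exact le_rfl
        · by_cases h : y + Pi.single μ 1 = x
          · rw [if_pos h, if_pos (eq_sub_of_add_eq h)]
            exact_mod_cast hc _
          · rw [if_neg h]
            split_ifs <;> positivity
    _ = 2 * ν * (N : ℝ) ^ 2 := by
        rw [Finset.sum_comm]
        simp only [mul_add, Finset.sum_add_distrib, mul_ite, mul_zero, Finset.sum_ite_eq',
          Finset.mem_univ, if_true, Finset.sum_const, Finset.card_univ, Fintype.card_fin,
          nsmul_eq_mul]
        ring

/-- **(3.28) for the NJL system on the torus**: `Z_Λ(m) ≠ 0` whenever `‖m‖ ≥ √(2ν)`, `m ≠ 0` —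
the zeros of `Z_Λ` stay in a bounded set independent of `N` and `|Λ|` (Heilmann–Lieb's
`|x| < 2√B₁`; the tree's constant `√(2ν)` in the normalisation `F = e^{2Nmz}`, `B = e^{Nt}` is at
least as good as the printed `2√(2νN)`). [cite: SalmhoferSeiler1991, (3.28)][cite: HeilmannLieb1972, Thm. 4.3] -/
theorem njlPartitionFunctionC_ne_zero_of_sqrt_le_norm (N : ℕ) {m : ℂ} (hm0 : m ≠ 0)
    (hm : Real.sqrt (2 * ν) ≤ ‖m‖) : njlPartitionFunctionC (ν := ν) (L := L) N m ≠ 0 := by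
  rw [njlPartitionFunctionC_eq_Z]
  rcases Nat.eq_zero_or_pos N with h0 | hN
  · subst h0
    rw [njl_Z_topExponent_zero]
    exact one_ne_zero
  · have hN' : (0 : ℝ) < N := by exact_mod_cast hN
    have hm' : 0 < ‖m‖ := norm_pos_iff.2 hm0
    have hsq : 2 * (ν : ℝ) ≤ ‖m‖ ^ 2 := by
      calc 2 * (ν : ℝ) = Real.sqrt (2 * ν) ^ 2 := (Real.sq_sqrt (by positivity)).symm
        _ ≤ ‖m‖ ^ 2 := pow_le_pow_left₀ (Real.sqrt_nonneg _) hm 2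
    refine (heilmannLieb_rootBound (w := fun _ => (N : ℝ)) (fun x => isExpData_njlSiteData N m x)
      (fun b => isExpData_njlBondData N b) (fun _ => Nat.cast_nonneg N) (R := 2 * N * ‖m‖)
      (by positivity) (fun x => (norm_two_mul_natCast_mul N m).symm.le) _
      (fun x => (topExponent_apply' N x).le) (fun x => ?_)).1
    calc 4 * weightedDegree linkSrc linkTgt (fun _ => (N : ℝ)) (topExponent N) x
        ≤ 4 * (2 * ν * (N : ℝ) ^ 2) :=
          mul_le_mul_of_nonneg_left (njl_weightedDegree_le N (fun y => (topExponent_apply' N y).le) x)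
            (by norm_num)
      _ ≤ (2 * N * ‖m‖) ^ 2 := by nlinarith

/-- **Location of the zeros of `Z_Λ(m)`** (Thm. 3.6 with (3.28)): a zero of the finite-volume NJL
partition function is purely imaginary with `|m| < √(2ν)` (or `m = 0`), uniformly in `N` and `Λ`.
[cite: SalmhoferSeiler1991, Thm. 3.6 and (3.28)] -/
theorem njlPartitionFunctionC_eq_zero_imp (N : ℕ) {m : ℂ}
    (h : njlPartitionFunctionC (ν := ν) (L := L) N m = 0) :
    m.re = 0 ∧ (m = 0 ∨ ‖m‖ < Real.sqrt (2 * ν)) := by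
  by_contra hc
  rcases not_and_or.1 hc with h1 | h2
  · exact njlPartitionFunctionC_ne_zero_of_re_ne_zero N h1 h
  · have hm0 : m ≠ 0 := fun h0 => h2 (Or.inl h0)
    have hle : Real.sqrt (2 * ν) ≤ ‖m‖ := not_lt.1 fun hlt => h2 (Or.inr hlt)
    exact njlPartitionFunctionC_ne_zero_of_sqrt_le_norm N hm0 hle h

/-- **The printed region `𝒲 = ℂ ∖ 2i[-√(2νN), √(2νN)]`** (p. 407): `Z_Λ(m) ≠ 0` for every `m ∈ 𝒲`
and every volume (`N ≥ 1`). [cite: SalmhoferSeiler1991, Thm. 3.6, (3.28) and Thm. 3.8] -/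
theorem njlPartitionFunctionC_ne_zero_of_mem_printedRegion {N : ℕ} (hN : 1 ≤ N) {m : ℂ}
    (hm : ¬ (m.re = 0 ∧ |m.im| ≤ 2 * Real.sqrt (2 * ν * N))) :
    njlPartitionFunctionC (ν := ν) (L := L) N m ≠ 0 := by
  rcases not_and_or.1 hm with h1 | h2
  · exact njlPartitionFunctionC_ne_zero_of_re_ne_zero N h1
  · have h2' : 2 * Real.sqrt (2 * ν * N) < |m.im| := not_le.1 h2
    have hs : Real.sqrt (2 * ν) ≤ 2 * Real.sqrt (2 * ν * N) := by
      have hN' : (1 : ℝ) ≤ N := by exact_mod_cast hN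
      have hν : (0 : ℝ) ≤ ν := Nat.cast_nonneg ν
      calc Real.sqrt (2 * ν) ≤ Real.sqrt (2 * ν * N) := Real.sqrt_le_sqrt (by nlinarith)
        _ ≤ 2 * Real.sqrt (2 * ν * N) := by linarith [Real.sqrt_nonneg (2 * ν * N)]
    have him : |m.im| ≤ ‖m‖ := Complex.abs_im_le_norm m
    have hm0 : m ≠ 0 := by
      intro h0
      rw [h0, Complex.zero_im, abs_zero] at h2'
      linarith [Real.sqrt_nonneg (2 * ν * N)]
    exact njlPartitionFunctionC_ne_zero_of_sqrt_le_norm N hm0 (by linarith)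

/-! ### Analyticity in the mass (Cor. 3.9 in finite volume) -/

/-- The NJL site data as polynomials in the mass variable. [cite: SalmhoferSeiler1991, (3.58)] -/
def njlSiteDataPoly (N : ℕ) : TorusSite ν L → ℕ → Polynomial ℂ :=
  fun _ j => Polynomial.C ((2 * N : ℂ) ^ j / (Nat.factorial j : ℂ)) * Polynomial.X ^ j

/-- The NJL bond data as (constant) polynomials in the mass variable. [cite: SalmhoferSeiler1991, Def. 3.3(1)] -/
def njlBondDataPoly (N : ℕ) : TorusSite ν L × Fin ν → ℕ → Polynomial ℂ :=
  fun _ j => Polynomial.C ((njlBondCoeff N j : ℝ) : ℂ)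

/-- `[Φ]_Λ` as a polynomial in the mass. [cite: SalmhoferSeiler1991, Thm. 3.8(2)] -/
def njlBracketPoly (N : ℕ) (Φ : FieldAlg ν L) : Polynomial ℂ :=
  coeff (topExponent N) (MvPolynomial.map Polynomial.C Φ *
    MonomerDimer.boltzmann N linkSrc linkTgt (njlSiteDataPoly N) (njlBondDataPoly (ν := ν) (L := L) N))

/-- Evaluating the bracket polynomial at `m` gives `[Φ]_Λ(m)`. [cite: SalmhoferSeiler1991, Thm. 3.8(2)] -/
theorem eval_njlBracketPoly (N : ℕ) (Φ : FieldAlg ν L) (m : ℂ) :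
    (njlBracketPoly N Φ).eval m = njlBracketC N m Φ := by
  unfold njlBracketPoly njlBracketC njlBoltzmannC
  rw [← Polynomial.coe_evalRingHom, ← coeff_map, map_mul, MonomerDimer.map_boltzmann,
    MvPolynomial.map_map]
  have hC : (Polynomial.evalRingHom m).comp Polynomial.C = RingHom.id ℂ := by
    ext z; simp
  have hs : (fun x j => Polynomial.evalRingHom m (njlSiteDataPoly (ν := ν) (L := L) N x j)) =
      njlSiteData N m := by
    funext x j
    simp [njlSiteDataPoly, njlSiteData, mul_pow]
    ring
  have hb : (fun b j => Polynomial.evalRingHom m (njlBondDataPoly (ν := ν) (L := L) N b j)) =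
      njlBondData N := by
    funext b j
    simp [njlBondDataPoly, njlBondData]
  rw [hC, map_id, hs, hb]

/-- **`m ↦ [Φ]_Λ(m)` is entire** (a polynomial in `m`). [cite: SalmhoferSeiler1991, Thm. 3.8(2)] -/
theorem differentiable_njlBracketC (N : ℕ) (Φ : FieldAlg ν L) :
    Differentiable ℂ fun m => njlBracketC N m Φ := by
  simp_rw [← eval_njlBracketPoly]
  exact Polynomial.differentiable _

/-- **`m ↦ Z_Λ(m)` is entire.** [cite: SalmhoferSeiler1991, Thm. 3.8(2)] -/
theorem differentiable_njlPartitionFunctionC (N : ℕ) :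
    Differentiable ℂ fun m => njlPartitionFunctionC (ν := ν) (L := L) N m :=
  differentiable_njlBracketC N 1

/-- **Cor. 3.9 in finite volume**: every correlation function `m ↦ ⟨Φ⟩_Λ(m)` of the NJL system is
holomorphic off the zeros of `Z_Λ`. [cite: SalmhoferSeiler1991, Thm. 3.8(2) and Cor. 3.9] -/
theorem differentiableOn_njlExpectC (N : ℕ) (Φ : FieldAlg ν L) :
    DifferentiableOn ℂ (fun m => njlExpectC N m Φ)
      {m | njlPartitionFunctionC (ν := ν) (L := L) N m ≠ 0} :=
  (differentiable_njlBracketC N Φ).differentiableOn.div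
    (differentiable_njlPartitionFunctionC N).differentiableOn fun _ hm => hm

/-- **Cor. 3.9 in finite volume, real-part form**: `m ↦ ⟨Φ⟩_Λ(m)` is holomorphic on the two open
half planes `Re m ≠ 0`, for every volume — "a phase transition can occur in a NJL model only if
`m = 0`" at the level of Lee–Yang zeros. [cite: SalmhoferSeiler1991, Cor. 3.9] -/
theorem differentiableOn_njlExpectC_of_re (N : ℕ) (Φ : FieldAlg ν L) :
    DifferentiableOn ℂ (fun m => njlExpectC N m Φ) {m | m.re ≠ 0} :=
  (differentiableOn_njlExpectC N Φ).mono fun _ hm => njlPartitionFunctionC_ne_zero_of_re_ne_zero N hm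

/-- **Cor. 3.9 in finite volume, printed region**: `m ↦ ⟨Φ⟩_Λ(m)` is holomorphic on
`𝒲 = ℂ ∖ 2i[-√(2νN), √(2νN)]` for every volume (`N ≥ 1`). [cite: SalmhoferSeiler1991, Thm. 3.8(2) and Cor. 3.9] -/
theorem differentiableOn_njlExpectC_printedRegion {N : ℕ} (hN : 1 ≤ N) (Φ : FieldAlg ν L) :
    DifferentiableOn ℂ (fun m => njlExpectC N m Φ)
      {m | ¬ (m.re = 0 ∧ |m.im| ≤ 2 * Real.sqrt (2 * ν * N))} :=
  (differentiableOn_njlExpectC N Φ).mono fun _ hm =>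
    njlPartitionFunctionC_ne_zero_of_mem_printedRegion hN hm

/-! ### Uniform bounds on the correlation functions at complex mass -/

/-- Total capacity bookkeeping: `|N| - |N - l| = |l|` for `l ≤ N`. [folklore] -/
private theorem degree_top_sub {N : ℕ} {l : TorusSite ν L →₀ ℕ} (hl : l ≤ topExponent N) :
    (topExponent (ν := ν) (L := L) N).degree - (topExponent N - l).degree = l.degree := by
  have h := congrArg Finsupp.degree (tsub_add_cancel_of_le hl)
  rw [map_add] at h
  omega

/-- **Uniform bound off the imaginary axis** (the constant of the Erratum to Thm. 3.11): for
`Re m ≠ 0` and every multi-index `l`, `|⟨σ^l⟩_Λ(m)| ≤ (2|Re m|)^{-|l|}`, uniformly in the volume.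
For real `m` the paper uses `|⟨σ^L⟩_Λ| ≤ 1` (Thm. 3.18(1)); for complex `m` this negative power of
`|Re m|` is what the Heilmann–Lieb recursion gives. [cite: SalmhoferSeiler1992Erratum, (5)][cite: HeilmannLieb1972, Lemma 4.7] -/
theorem norm_njlExpectC_monomial_le_of_re {N : ℕ} (hN : 1 ≤ N) {m : ℂ} (hm : m.re ≠ 0)
    (l : TorusSite ν L →₀ ℕ) :
    ‖njlExpectC N m (monomial l 1)‖ ≤ (2 * |m.re|)⁻¹ ^ l.degree := by
  unfold njlExpectC
  rw [njlBracketC_monomial, njlPartitionFunctionC_eq_Z]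
  split_ifs with hl
  · set ε : ℝ := if 0 < m.re then 1 else -1 with hεdef
    have hε : ε = 1 ∨ ε = -1 := by
      by_cases h : 0 < m.re
      · exact Or.inl (if_pos h)
      · exact Or.inr (if_neg h)
    have hεm : ε * m.re = |m.re| := by
      by_cases h : 0 < m.re
      · rw [hεdef, if_pos h, one_mul, abs_of_pos h]
      · rw [hεdef, if_neg h, abs_of_nonpos (not_lt.1 h)]; ring
    have hN' : (0 : ℝ) < N := by exact_mod_cast hN
    have hρ : 0 < 2 * N * |m.re| := by positivity
    have key := norm_Z_div_Z_le_of_re (s := linkSrc) (t := linkTgt) (w := fun _ => (N : ℝ))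
      (fun x => isExpData_njlSiteData (ν := ν) (L := L) N m x) (fun b => isExpData_njlBondData N b)
      hε hρ (fun x => by rw [re_two_mul_natCast_mul, ← hεm]; exact le_of_eq (by ring))
      (fun _ => Nat.cast_nonneg N) (tsub_le_self : topExponent N - l ≤ topExponent N)
      (fun x => (topExponent_apply' N x).le)
    rw [degree_top_sub hl] at key
    refine key.trans (le_of_eq ?_)
    congr 1
    field_simp
  · rw [zero_div, norm_zero]
    positivity

/-- **Uniform bound far from the origin**: for `‖m‖ ≥ √(2ν)`, `m ≠ 0`, and every multi-index `l`,
`|⟨σ^l⟩_Λ(m)| ≤ ‖m‖^{-|l|}`, uniformly in the volume (the regime of the convergent hopping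
expansion, Remark 3.10). [cite: SalmhoferSeiler1991, (3.28) and Remark 3.10][cite: HeilmannLieb1972, Lemma 4.4] -/
theorem norm_njlExpectC_monomial_le_of_norm {N : ℕ} (hN : 1 ≤ N) {m : ℂ} (hm0 : m ≠ 0)
    (hm : Real.sqrt (2 * ν) ≤ ‖m‖) (l : TorusSite ν L →₀ ℕ) :
    ‖njlExpectC N m (monomial l 1)‖ ≤ ‖m‖⁻¹ ^ l.degree := by
  unfold njlExpectC
  rw [njlBracketC_monomial, njlPartitionFunctionC_eq_Z]
  split_ifs with hl
  · have hN' : (0 : ℝ) < N := by exact_mod_cast hN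
    have hm' : 0 < ‖m‖ := norm_pos_iff.2 hm0
    have hsq : 2 * (ν : ℝ) ≤ ‖m‖ ^ 2 := by
      calc 2 * (ν : ℝ) = Real.sqrt (2 * ν) ^ 2 := (Real.sq_sqrt (by positivity)).symm
        _ ≤ ‖m‖ ^ 2 := pow_le_pow_left₀ (Real.sqrt_nonneg _) hm 2
    have key := norm_Z_div_Z_le_of_norm (s := linkSrc) (t := linkTgt) (w := fun _ => (N : ℝ))
      (fun x => isExpData_njlSiteData (ν := ν) (L := L) N m x) (fun b => isExpData_njlBondData N b)
      (fun _ => Nat.cast_nonneg N) (R := 2 * N * ‖m‖) (by positivity)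
      (fun x => (norm_two_mul_natCast_mul N m).symm.le)
      (tsub_le_self : topExponent N - l ≤ topExponent N) (fun x => (topExponent_apply' N x).le)
      (fun x => by
        calc 4 * weightedDegree linkSrc linkTgt (fun _ => (N : ℝ)) (topExponent N) x
            ≤ 4 * (2 * ν * (N : ℝ) ^ 2) :=
              mul_le_mul_of_nonneg_left
                (njl_weightedDegree_le N (fun y => (topExponent_apply' N y).le) x) (by norm_num)
          _ ≤ (2 * N * ‖m‖) ^ 2 := by nlinarith)
    rw [degree_top_sub hl] at key
    refine key.trans (le_of_eq ?_)
    congr 1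
    field_simp
  · rw [zero_div, norm_zero]
    positivity

/-- **Uniform bound at real mass, in the tree's real vocabulary**: for real `m ≠ 0`,
`|⟨σ^l⟩_Λ| ≤ (2|m|)^{-|l|}` for the NJL system in every volume. [cite: SalmhoferSeiler1992Erratum, (5)] -/
theorem njl_abs_expect_monomial_le {N : ℕ} (hN : 1 ≤ N) {m : ℝ} (hm : m ≠ 0)
    (l : TorusSite ν L →₀ ℕ) :
    |expect N m (njlBondCoeff N) (monomial l 1)| ≤ (2 * |m|)⁻¹ ^ l.degree := by
  have h := norm_njlExpectC_monomial_le_of_re (ν := ν) (L := L) hN (m := (m : ℂ))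
    (by rwa [Complex.ofReal_re]) l
  rwa [Complex.ofReal_re, show (monomial l (1 : ℂ) : FieldAlg ν L) =
      MvPolynomial.map Complex.ofRealHom (monomial l (1 : ℝ)) by
        rw [map_monomial, Complex.ofRealHom_eq_coe, Complex.ofReal_one],
    njlExpectC_ofReal, Complex.norm_real, Real.norm_eq_abs] at h

end ComplexSpin

end Literature.MathematicalPhysics.StatisticalMechanics
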